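import Summits.Ventures.PercRepro.ProfilePointedCircuitClassesReduction

/-!
# PercRepro — THE PER-POINT IN–OUT INEQUALITY AT THE BOTTOM OF NULLITY 4 HOLDS AT EVERY POINT WITH A PARALLEL TWIN
(p5, gen 37; `proofs/P5-GM1.md` §53 ADDENDUM 1 (3): the twin case of `InOutBottomFour`)

If `e ∥ f` (`rk{e} = rk{f} = rk{e, f} = 1`), the bi-independent `k`-sets containing `e` are the class of the circuit
`{e} + f` at the level `k` (`e ∈ W` forces `f ∉ W`), hence — by the reduction `gammaC_eq_thruCount_contract_delete` —
in bijection with the bi-independent `(k − 1)`-sets of the minor `N ／ f ∖ e` (nullity `3`, `n − 2` points): `in_k(e) =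
P_{k−1}(N ／ f ∖ e)`, and by complementation `out_5(e) = in_{n−5}(e) = P_{n−6}(N ／ f ∖ e) = P_4(N ／ f ∖ e)`.  So
`in_4(e) ≤ out_5(e)` IS the weak step `P_3 ≤ P_4` of the nullity-3 minor — the kernel's
`biIndep_step_three_of_nullity_three`.  The missing inequality of the nullity-5 chain is therefore open only at the
points WITHOUT a parallel twin.
-/

open scoped Matroid

namespace PercRepro.Cogirth

open Finset ThmH Skew Shadow Profile

variable {α : Type} [DecidableEq α] {N : Matroid α} [N.Finite]

section InOutParallel

/-- For `e ∥ f`, the bi-independent `k`-sets containing `e` are exactly the class of the circuit `{e} + f`. -/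
theorem inCount_eq_gammaC_of_parallel {e f : α} (hef : e ≠ f) (he : e ∈ gr N) (hf : f ∈ gr N)
    (hre : rk N {e} = 1) (hrf : rk N {f} = 1) (hfcl : f ∈ clF N {e}) (k : ℕ) :
    inCount N k e = gammaC N k f {e} := by
  unfold inCount gammaC
  congr 1
  apply filter_congr
  intro W hW
  have hW' := hW
  rw [mem_biIndepSets] at hW'
  obtain ⟨hWg, _, hWrk, _⟩ := hW'
  have hC : ({e} : Finset α) ⊆ gr N := singleton_subset_iff.2 he
  have hxC : f ∉ ({e} : Finset α) := by rw [mem_singleton]; exact fun h => hef h.symm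
  have hrk : rk N {e} = ({e} : Finset α).card := by rw [hre, card_singleton]
  have hfund : ∀ c ∈ ({e} : Finset α), f ∉ clF N (({e} : Finset α).erase c) := by
    intro c hc
    rw [mem_singleton] at hc
    rw [hc, erase_singleton]
    intro h0
    have h := rk_insert_eq hf (empty_subset (gr N)) (M := N)
    rw [insert_empty, if_pos h0] at h
    have h1 : rk N ∅ = 0 := Nat.le_zero.1 ((rk_le_card (M := N) ∅).trans (by rw [card_empty]))
    omega
  rw [class_iff_of_circuit hC hf hrk hfcl hfund hW]
  constructor
  · intro heW
    refine ⟨singleton_subset_iff.2 heW, ?_⟩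
    intro hfW
    -- `{e, f} ⊆ W` has rank `1 < 2`
    have hsub : ({e, f} : Finset α) ⊆ W := insert_subset heW (singleton_subset_iff.2 hfW)
    have h1 := rk_eq_card_of_subset_of_rk_eq_card hsub hWrk
    rw [card_pair hef] at h1
    have h2 : rk N (insert f {e}) = rk N {e} := by
      rw [rk_insert_eq hf (singleton_subset_iff.2 he), if_pos hfcl]
    have e1 : ({e, f} : Finset α) = insert f {e} := pair_comm e f
    rw [e1, h2, hre] at h1
    omega
  · rintro ⟨hCW, _⟩
    exact hCW (mem_singleton_self e)

/-- **THE TWIN CASE OF `InOutBottomFour`**: on `#E = ρ(E) + 4`, `ρ(E) ≥ 6`, every point `e` with a parallel twin `f`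
satisfies `in_4(e) ≤ out_5(e)` — it is `P_3 ≤ P_4` on the nullity-3 minor `N ／ f ∖ e`
(`biIndep_step_three_of_nullity_three`). -/
theorem inCount_four_le_outCount_five_of_parallel (hn : (gr N).card = rk N (gr N) + 4)
    (hR : 6 ≤ rk N (gr N)) {e f : α} (hef : e ≠ f) (he : e ∈ gr N) (hf : f ∈ gr N)
    (hre : rk N {e} = 1) (hrf : rk N {f} = 1) (hfcl : f ∈ clF N {e}) :
    inCount N 4 e ≤ outCount N 5 e := by
  -- both sides as classes of the circuit `{e} + f`, then as profile values of `N ／ f ∖ e`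
  have hC : ({e} : Finset α) ⊆ gr N := singleton_subset_iff.2 he
  have hxC : f ∉ ({e} : Finset α) := by rw [mem_singleton]; exact fun h => hef h.symm
  have hrk : rk N {e} = ({e} : Finset α).card := by rw [hre, card_singleton]
  have hfund : ∀ c ∈ ({e} : Finset α), f ∉ clF N (({e} : Finset α).erase c) := by
    intro c hc
    rw [mem_singleton] at hc
    rw [hc, erase_singleton]
    intro h0
    have h := rk_insert_eq hf (empty_subset (gr N)) (M := N)
    rw [insert_empty, if_pos h0] at h
    have h1 : rk N ∅ = 0 := Nat.le_zero.1 ((rk_le_card (M := N) ∅).trans (by rw [card_empty]))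
    omega
  have hout : outCount N 5 e = inCount N ((gr N).card - 5) e :=
    (inCount_sub_eq_outCount (M := N) (k := 5) he (by omega)).symm
  rw [hout, inCount_eq_gammaC_of_parallel hef he hf hre hrf hfcl,
    inCount_eq_gammaC_of_parallel hef he hf hre hrf hfcl,
    gammaC_eq_thruCount_contract_delete hC hf hxC hrk hfcl hfund (mem_singleton_self e) (by norm_num),
    gammaC_eq_thruCount_contract_delete hC hf hxC hrk hfcl hfund (mem_singleton_self e) (by omega),
    erase_singleton, thruCount_empty, thruCount_empty]
  -- the minor `N₃ := N ／ f ∖ e`: `n − 2` points, rank `ρ − 1`, nullity `3`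
  have hgr₀ : gr ((N ／ ({f} : Set α)) ＼ ({e} : Set α)) = ((gr N).erase f).erase e := by
    rw [gr_delete', gr_contract']
  have hfind : N.Indep ({f} : Set α) := by
    have := indep_of_rk_eq_card' (M := N) (X := {f}) (by rw [hrf, card_singleton])
    simpa using this
  have hrk₀ : ∀ X : Finset α, X ⊆ ((gr N).erase f).erase e →
      rk ((N ／ ({f} : Set α)) ＼ ({e} : Set α)) X + 1 = rk N (insert f X) := by
    intro X hX
    have hX' : X ⊆ (gr (N ／ ({f} : Set α))).erase e := by rw [gr_contract']; exact hX
    have hX'' : X ⊆ (gr N).erase f := hX.trans (erase_subset _ _)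
    rw [rk_delete hX', rk_contract_add_one hfind hX'']
  have hcard₀ : (((gr N).erase f).erase e).card = (gr N).card - 2 := by
    rw [card_erase_of_mem (mem_erase.2 ⟨hef, he⟩), card_erase_of_mem hf]
    omega
  -- `e ∈ cl{f}` (parallel is symmetric)
  have hecl : e ∈ clF N {f} := by
    by_contra h
    have h1 := rk_insert_eq he (singleton_subset_iff.2 hf) (M := N) (e := e) (X := {f})
    rw [if_neg h, hrf] at h1
    have h2 : rk N (insert f {e}) = rk N {e} := by
      rw [rk_insert_eq hf (singleton_subset_iff.2 he), if_pos hfcl]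
    have e1 : (insert e {f} : Finset α) = insert f {e} := pair_comm e f
    rw [e1, h2, hre] at h1
    omega
  have hrkg₀ : rk ((N ／ ({f} : Set α)) ＼ ({e} : Set α)) (((gr N).erase f).erase e) = rk N (gr N) - 1 := by
    have h := hrk₀ _ (Subset.refl _)
    have e1 : insert f (((gr N).erase f).erase e) = (gr N).erase e := by
      ext a
      simp only [mem_insert, mem_erase]
      constructor
      · rintro (rfl | ⟨hae, _, hag⟩)
        · exact ⟨fun h' => hef h'.symm, hf⟩
        · exact ⟨hae, hag⟩
      · rintro ⟨hae, hag⟩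
        by_cases haf : a = f
        · exact Or.inl haf
        · exact Or.inr ⟨hae, haf, hag⟩
    have hecl' : e ∈ clF N ((gr N).erase e) :=
      mem_clF_of_subset (singleton_subset_iff.2 (mem_erase.2 ⟨fun h' => hef h'.symm, hf⟩)) hecl
    have h2 : rk N (insert e ((gr N).erase e)) = rk N ((gr N).erase e) := by
      rw [rk_insert_eq he (erase_subset e (gr N)), if_pos hecl']
    rw [insert_erase he] at h2
    rw [e1, ← h2] at h
    omega
  have hn₀ : (gr ((N ／ ({f} : Set α)) ＼ ({e} : Set α))).card =
      rk ((N ／ ({f} : Set α)) ＼ ({e} : Set α)) (gr ((N ／ ({f} : Set α)) ＼ ({e} : Set α))) + 3 := by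
    rw [hgr₀, hcard₀, hrkg₀]
    omega
  have hR₀ : 4 ≤ rk ((N ／ ({f} : Set α)) ＼ ({e} : Set α)) (gr ((N ／ ({f} : Set α)) ＼ ({e} : Set α))) := by
    rw [hgr₀, hrkg₀]
    omega
  have hstep := biIndep_step_three_of_nullity_three (N := (N ／ ({f} : Set α)) ＼ ({e} : Set α)) hn₀ hR₀
  have hsym := card_biIndepSets_symm ((N ／ ({f} : Set α)) ＼ ({e} : Set α)) (k := 4)
    (by rw [hgr₀, hcard₀]; omega)
  rw [hgr₀, hcard₀] at hstep hsym
  have e2 : (gr N).card - 5 - 1 = (gr N).card - 2 - 4 := by omega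
  have e3 : (4 : ℕ) - 1 = 3 := by norm_num
  rw [e2, ← hsym, e3]
  have h5 : 4 ≤ (gr N).card - 2 - 3 := by omega
  have h6 := Nat.mul_le_mul_right (biIndepSets ((N ／ ({f} : Set α)) ＼ ({e} : Set α)) 3).card h5
  omega

end InOutParallel

end PercRepro.Cogirth
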